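import Literature.Topology.PlaneTopology.EilenbergCriterion
import HarnessLib

/-!
# Proof of the Jordan curve theorem

Topic: Topology / PlaneTopology. Third file of the continuous-logarithm proof of the Jordan
curve theorem; it discharges the named fact `Literature.Topology.PlaneTopology.JordanCurveTheorem` of `JordanCurve.lean`
[Mccleary2006, Ch. 9, p. 129] as `JordanCurveTheorem_holds`. Let `C ⊆ ℂ` with
`e : ℝ/ℤ ≃ₜ C` and `γ t = e (t mod 1)` the associated `1`-periodic parametrisation.

1. (`hasLogOn_iff_wind_eq_zero`) A continuous nonvanishing `F` on `C` has a continuous logarithm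
   on `C` iff `wind (F ∘ γ) = 0` (lift along `γ`; a periodic lift descends to `ℝ/ℤ ≅ C`).
2. (`mem_or_mem_of_ne`, *at most two components*) If the components `U_a ∋ a`, `U_b ∋ b` of
   `ℂ \ C` are distinct and both bounded, put `d_a = wind (γ - a)`, `d_b = wind (γ - b)`; the
   loop `(γ - b)^{d_a} (γ - a)^{-d_b}` has winding number `0`, so `(z - b)^{d_a}(z - a)^{-d_b}`
   has a logarithm on `C`, and the independence lemma (`EilenbergCriterion.lean`) at `b` forces
   `d_a = 0`; then `z - a` has a logarithm on `C`, contradicting the independence lemma at `a`.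
   Since of two distinct components one is bounded, three distinct components are impossible.
3. (`exists_ne_connectedComponentIn`, *separation*) Let `p = γ 0`, `q = γ (1/2)` and
   `A₁ = γ [0, ½]`, `A₂ = γ [½, 1]`, so `A₁ ∪ A₂ = C`, `A₁ ∩ A₂ = {p, q}`. Sliding `p` to `q` along
   `A₁` is a nonvanishing homotopy on `ℂ \ A₁` from `(z - p)/(z - q)` to `1`, so `(z - p)/(z - q)`
   has a logarithm on `ℂ \ A₁`; likewise on `ℂ \ A₂`. If `ℂ \ C = (ℂ \ A₁) ∩ (ℂ \ A₂)` were
   connected the two logarithms would glue to one on `ℂ \ {p, q}`, but on a small circle about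
   `p` the loop `(z - p)/(z - q)` has winding number `1 - 0 = 1`.
4. (`frontier_connectedComponentIn_eq`, *common boundary*) `∂U ⊆ C` for every component `U`;
   if `∂U` missed a point of `C` it would lie in an arc `Λ = γ [t₀ + δ, t₀ + 1 - δ] ⊊ C`, whose
   complement is connected (`JordanArcSeparation_holds`), contains `U` and avoids `∂U`, hence
   lies inside `U` — impossible since `ℂ \ Λ ⊇ ℂ \ C` meets another component (step 3).

## References
* S. Eilenberg, Transformations continues en circonférence et la topologie du plan, Fund. Math.
  26 (1936) 61–112. [Eilenberg1936]
* J. McCleary, *A First Course in Topology*, AMS (2006), Ch. 9. [Mccleary2006]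
-/

noncomputable section

namespace Literature.Topology.PlaneTopology

open Complex Set _root_.Topology Filter Metric Bornology
open scoped Real

namespace JordanCurveProof

variable {C : Set ℂ}

/-! ### The periodic parametrisation attached to `e : ℝ/ℤ ≃ₜ C` -/

/-- The `1`-periodic parametrisation `t ↦ e (t mod 1)` of `C`. [folklore] -/
def param (e : AddCircle (1 : ℝ) ≃ₜ C) (t : ℝ) : ℂ := e (t : AddCircle (1 : ℝ))

/-- Two reals have the same class in `ℝ/ℤ` iff they differ by an integer. [folklore] -/
theorem coe_eq_coe_iff_exists_int {s t : ℝ} :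
    ((s : AddCircle (1 : ℝ)) = t) ↔ ∃ n : ℤ, t = s + n := by
  rw [QuotientAddGroup.eq, AddSubgroup.mem_zmultiples_iff]
  constructor
  · rintro ⟨n, hn⟩
    refine ⟨n, ?_⟩
    rw [zsmul_eq_mul, mul_one] at hn
    linarith
  · rintro ⟨n, hn⟩
    exact ⟨n, by rw [zsmul_eq_mul, mul_one]; linarith⟩

variable (e : AddCircle (1 : ℝ) ≃ₜ C)
include e

/-- The parametrisation is continuous. [folklore] -/
theorem continuous_param : Continuous (param e) :=
  continuous_subtype_val.comp (e.continuous.comp (AddCircle.continuous_mk' (1 : ℝ)))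

/-- The parametrisation takes values in `C`. [folklore] -/
theorem param_mem (t : ℝ) : param e t ∈ C := (e _).2

/-- The parametrisation is `1`-periodic. [folklore] -/
theorem param_add_one (t : ℝ) : param e (t + 1) = param e t := by
  simp only [param, AddCircle.coe_add_period]

/-- In particular `γ 1 = γ 0`. [folklore] -/
theorem param_one : param e 1 = param e 0 := by
  have := param_add_one e 0
  rwa [zero_add] at this

/-- `γ s = γ t` iff `s` and `t` differ by an integer (`e` is injective). [folklore] -/
theorem param_eq_param_iff {s t : ℝ} : param e s = param e t ↔ ∃ n : ℤ, t = s + n := by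
  rw [← coe_eq_coe_iff_exists_int]
  simp only [param, Subtype.val_inj, e.injective.eq_iff]

/-- The parametrisation is injective on every period `[c, c + 1)`. [folklore] -/
theorem injOn_param_Ico (c : ℝ) : InjOn (param e) (Ico c (c + 1)) := by
  intro s hs t ht h
  obtain ⟨n, hn⟩ := (param_eq_param_iff e).1 h
  have h1 : (n : ℝ) < 1 := by linarith [hs.1, ht.2]
  have h2 : (-1 : ℝ) < n := by linarith [hs.2, ht.1]
  have : n = 0 := by
    have h1' : n < 1 := by exact_mod_cast h1
    have h2' : -1 < n := by exact_mod_cast h2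
    omega
  subst this
  simpa using hn.symm

/-- Every period `[c, c + 1)` is mapped onto `C`. [folklore] -/
theorem surjOn_param_Ico (c : ℝ) : SurjOn (param e) (Ico c (c + 1)) C := by
  intro z hz
  haveI : Fact ((0 : ℝ) < 1) := ⟨one_pos⟩
  refine ⟨(AddCircle.equivIco 1 c (e.symm ⟨z, hz⟩) : ℝ), (AddCircle.equivIco 1 c _).2, ?_⟩
  simp only [param, AddCircle.coe_equivIco, Homeomorph.apply_symm_apply]

/-- The range of the parametrisation is `C`. [folklore] -/
theorem range_param : range (param e) = C := by
  refine Subset.antisymm (range_subset_iff.2 (param_mem e)) fun z hz => ?_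
  obtain ⟨t, -, rfl⟩ := surjOn_param_Ico e 0 hz
  exact mem_range_self t

/-- `γ [0, 1] = C`. [folklore] -/
theorem image_param_Icc : param e '' Icc 0 1 = C := by
  refine Subset.antisymm (image_subset_iff.2 fun t _ => param_mem e t) fun z hz => ?_
  obtain ⟨t, ht, rfl⟩ := surjOn_param_Ico e 0 hz
  exact ⟨t, Ico_subset_Icc_self (by simpa using ht), rfl⟩

/-- `C` is compact. [folklore] -/
theorem isCompact_curve : IsCompact C := isCompact_of_homeomorphic_addCircle ⟨e⟩

/-- The loop `γ - a` for `a ∉ C`. [folklore] -/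
theorem isNonvanishingLoop_param_sub {a : ℂ} (ha : a ∉ C) :
    IsNonvanishingLoop fun t => param e t - a :=
  ⟨((continuous_param e).continuousOn).sub continuousOn_const,
    fun t _ => sub_ne_zero.2 fun h => ha (h ▸ param_mem e t), by rw [param_one]⟩

/-! ### Step 1: logarithms on `C` and winding numbers along `γ` -/

/-- A continuous nonvanishing map `F` on the Jordan curve `C` has a continuous logarithm on `C`
iff the loop `F ∘ γ` has winding number `0`. [folklore] -/
theorem hasLogOn_iff_wind_eq_zero {F : ℂ → ℂ} (hF : ContinuousOn F C) (hF0 : ∀ z ∈ C, F z ≠ 0) :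
    HasLogOn F C ↔ wind (F ∘ param e) = 0 := by
  classical
  constructor
  · intro h
    exact wind_comp_eq_zero_of_hasLogOn h (continuous_param e).continuousOn
      (fun t _ => param_mem e t) (param_one e).symm
  · intro h
    have hloop : IsNonvanishingLoop (F ∘ param e) :=
      ⟨hF.comp (continuous_param e).continuousOn fun t _ => param_mem e t,
        fun t _ => hF0 _ (param_mem e t), by simp [param_one]⟩
    obtain ⟨l, hl, hle, h01⟩ := (wind_eq_zero_iff hloop).1 h
    haveI : Fact ((0 : ℝ) < 1) := ⟨one_pos⟩
    set L : AddCircle (1 : ℝ) → ℂ := AddCircle.liftIco 1 0 l with hL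
    have hLc : Continuous L := AddCircle.liftIco_zero_continuous h01 hl
    have hLapply : ∀ x ∈ Ico (0 : ℝ) 1, L (x : AddCircle (1 : ℝ)) = l x := fun x hx =>
      AddCircle.liftIco_zero_coe_apply hx
    refine ⟨fun z => if hz : z ∈ C then L (e.symm ⟨z, hz⟩) else 0, ?_, fun z hz => ?_⟩
    · rw [continuousOn_iff_continuous_restrict]
      have : (C.restrict fun z => if hz : z ∈ C then L (e.symm ⟨z, hz⟩) else 0) =
          fun w => L (e.symm w) := by
        ext w
        simp [w.2]
      rw [this]
      exact hLc.comp e.symm.continuous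
    · simp only [hz, dif_pos]
      obtain ⟨x, hx, hxe⟩ : ∃ x ∈ Ico (0 : ℝ) 1, (x : AddCircle (1 : ℝ)) = e.symm ⟨z, hz⟩ :=
        ⟨(AddCircle.equivIco 1 0 (e.symm ⟨z, hz⟩) : ℝ), by
          simpa using (AddCircle.equivIco 1 0 (e.symm ⟨z, hz⟩)).2, AddCircle.coe_equivIco⟩
      rw [← hxe, hLapply x hx, hle x (Ico_subset_Icc_self hx)]
      simp [param, hxe]

/-- Points in the same component of `ℂ \ C` have the same winding number. [folklore] -/
theorem wind_sub_eq_of_mem {a b : ℂ} (ha : a ∉ C) (hb : b ∈ connectedComponentIn Cᶜ a) :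
    wind (fun t => param e t - a) = wind (fun t => param e t - b) := by
  have hbC : b ∉ C := fun h => connectedComponentIn_subset _ _ hb h
  have hlog := hasLogOn_div_sub_of_mem_connectedComponentIn (isCompact_curve e).isClosed hb
  have h0 := wind_comp_eq_zero_of_hasLogOn hlog (continuous_param e).continuousOn
    (fun t _ => param_mem e t) (param_one e).symm
  have h1 := wind_div (isNonvanishingLoop_param_sub e ha) (isNonvanishingLoop_param_sub e hbC)
  change wind (fun t => (param e t - a) / (param e t - b)) = 0 at h0
  omega

/-! ### Step 2: at most two components -/

/-- Two distinct components of `ℂ \ C` cannot both be bounded. [folklore] -/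
theorem not_isBounded_of_isBounded {a b : ℂ} (ha : a ∉ C) (hb : b ∉ C)
    (hUa : IsBounded (connectedComponentIn Cᶜ a)) (hUb : IsBounded (connectedComponentIn Cᶜ b))
    (hne : connectedComponentIn Cᶜ a ≠ connectedComponentIn Cᶜ b) : False := by
  have hC := isCompact_curve e
  set da := wind (fun t => param e t - a) with hda
  set db := wind (fun t => param e t - b) with hdb
  have haU : a ∉ connectedComponentIn Cᶜ b := fun h => hne (connectedComponentIn_eq h).symm
  have hacl : a ∉ closure (connectedComponentIn Cᶜ b) := fun h' =>
    (closure_connectedComponentIn_compl_subset hC.isClosed b h').elim haU ha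
  have hza : ∀ z ∈ closure (connectedComponentIn Cᶜ b), z - a ≠ 0 := fun z hz =>
    sub_ne_zero.2 fun h0 => hacl (h0 ▸ hz)
  have hla := isNonvanishingLoop_param_sub e ha
  have hlb := isNonvanishingLoop_param_sub e hb
  -- the independence lemma at `b` gives `da = 0`
  have hda0 : da = 0 := by
    refine eq_zero_of_hasLogOn_zpow_mul hC hb hUb (G := fun z => (z - a) ^ (-db)) (m := da)
      (ContinuousOn.zpow₀ (by fun_prop) _ fun z hz => Or.inl (hza z hz))
      (fun z hz => zpow_ne_zero _ (hza z hz)) ?_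
    refine (hasLogOn_iff_wind_eq_zero e ?_ ?_).2 ?_
    · refine ContinuousOn.mul (ContinuousOn.zpow₀ (by fun_prop) _ fun z hz => Or.inl ?_)
        (ContinuousOn.zpow₀ (by fun_prop) _ fun z hz => Or.inl ?_)
      · exact sub_ne_zero.2 fun h => hb (h ▸ hz)
      · exact sub_ne_zero.2 fun h => ha (h ▸ hz)
    · intro z hz
      exact mul_ne_zero (zpow_ne_zero _ (sub_ne_zero.2 fun h => hb (h ▸ hz)))
        (zpow_ne_zero _ (sub_ne_zero.2 fun h => ha (h ▸ hz)))
    · change wind (fun t => (param e t - b) ^ da * (param e t - a) ^ (-db)) = 0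
      rw [wind_mul (hlb.zpow da) (hla.zpow (-db)), wind_zpow hlb, wind_zpow hla, ← hda, ← hdb]
      ring
  -- hence `z - a` has a logarithm on `C`: contradiction
  have hlog : HasLogOn (fun z => z - a) C :=
    (hasLogOn_iff_wind_eq_zero e (F := fun z => z - a) (by fun_prop)
      fun z hz => sub_ne_zero.2 fun h => ha (h ▸ hz)).2 hda0
  exact not_hasLogOn_sub hC ha hUa hlog

/-- **At most two components**: if `x, y ∉ C` lie in distinct components of `ℂ \ C`, every point
of `ℂ \ C` lies in one of these two components. [folklore] -/
theorem mem_or_mem_of_ne {x y z : ℂ} (hx : x ∉ C) (hy : y ∉ C)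
    (hne : connectedComponentIn Cᶜ x ≠ connectedComponentIn Cᶜ y) (hz : z ∉ C) :
    z ∈ connectedComponentIn Cᶜ x ∨ z ∈ connectedComponentIn Cᶜ y := by
  by_contra h
  push Not at h
  have hCb := isCompact_curve e
  have hzx : connectedComponentIn Cᶜ z ≠ connectedComponentIn Cᶜ x := fun h' =>
    h.1 (h' ▸ mem_connectedComponentIn hz)
  have hzy : connectedComponentIn Cᶜ z ≠ connectedComponentIn Cᶜ y := fun h' =>
    h.2 (h' ▸ mem_connectedComponentIn hz)
  rcases isBounded_or_isBounded_of_ne hCb hne with hbx | hby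
  · rcases isBounded_or_isBounded_of_ne hCb hzy with hbz | hby'
    · exact not_isBounded_of_isBounded e hz hx hbz hbx hzx
    · exact not_isBounded_of_isBounded e hx hy hbx hby' hne
  · rcases isBounded_or_isBounded_of_ne hCb hzx with hbz | hbx'
    · exact not_isBounded_of_isBounded e hz hy hbz hby hzy
    · exact not_isBounded_of_isBounded e hx hy hbx' hby hne

/-! ### Step 3: `C` separates the plane -/

/-- The two arcs `γ [0, ½]` and `γ [½, 1]` meet only at `γ 0` and `γ ½`. [folklore] -/
theorem image_inter_image_subset :
    param e '' Icc 0 (1 / 2) ∩ param e '' Icc (1 / 2) 1 ⊆ {param e 0, param e (1 / 2)} := by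
  rintro z ⟨⟨s, hs, rfl⟩, ⟨t, ht, hst⟩⟩
  obtain ⟨n, hn⟩ := (param_eq_param_iff e).1 hst
  have h1 : (n : ℝ) ≤ 0 := by linarith [hs.2, ht.1]
  have h2 : (-1 : ℝ) ≤ n := by linarith [hs.1, ht.2]
  have hn' : n = 0 ∨ n = -1 := by
    have h1' : n ≤ 0 := by exact_mod_cast h1
    have h2' : -1 ≤ n := by exact_mod_cast h2
    omega
  rcases hn' with rfl | rfl
  · have : s = 1 / 2 := by
      simp only [Int.cast_zero, add_zero] at hn
      linarith [hs.2, ht.1]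
    subst this
    exact Or.inr rfl
  · have : s = 0 := by
      simp only [Int.reduceNeg, Int.cast_neg, Int.cast_one] at hn
      linarith [hs.1, ht.2]
    subst this
    exact Or.inl rfl

/-- **Separation**: the complement of `C` has at least two components. [folklore] -/
theorem exists_ne_connectedComponentIn :
    ∃ a b : ℂ, a ∉ C ∧ b ∉ C ∧ connectedComponentIn Cᶜ a ≠ connectedComponentIn Cᶜ b := by
  by_contra hall
  push Not at hall
  have hC := isCompact_curve e
  set p := param e 0 with hp
  set q := param e (1 / 2) with hq
  have hpq : p ≠ q := by
    intro h
    obtain ⟨n, hn⟩ := (param_eq_param_iff e).1 h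
    have h1 : (0 : ℝ) < n := by linarith
    have h2 : (n : ℝ) < 1 := by linarith
    have h1' : 0 < n := by exact_mod_cast h1
    have h2' : n < 1 := by exact_mod_cast h2
    omega
  set A₁ := param e '' Icc 0 (1 / 2) with hA₁
  set A₂ := param e '' Icc (1 / 2) 1 with hA₂
  have hA₁c : IsClosed A₁ := ((isCompact_Icc).image (continuous_param e)).isClosed
  have hA₂c : IsClosed A₂ := ((isCompact_Icc).image (continuous_param e)).isClosed
  have hunion : A₁ ∪ A₂ = C := by
    rw [hA₁, hA₂, ← image_union, Icc_union_Icc_eq_Icc (by norm_num) (by norm_num), image_param_Icc]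
  have hp₁ : p ∈ A₁ := ⟨0, ⟨le_rfl, by norm_num⟩, rfl⟩
  have hq₁ : q ∈ A₁ := ⟨1 / 2, ⟨by norm_num, le_rfl⟩, rfl⟩
  have hp₂ : p ∈ A₂ := ⟨1, ⟨by norm_num, le_rfl⟩, param_one e⟩
  have hq₂ : q ∈ A₂ := ⟨1 / 2, ⟨le_rfl, by norm_num⟩, rfl⟩
  have hmem₁ : ∀ s ∈ Icc (0 : ℝ) 1, param e (s / 2) ∈ A₁ := fun s hs =>
    ⟨s / 2, ⟨by linarith [hs.1], by linarith [hs.2]⟩, rfl⟩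
  have hmem₂ : ∀ s ∈ Icc (0 : ℝ) 1, param e (1 / 2 + s / 2) ∈ A₂ := fun s hs =>
    ⟨1 / 2 + s / 2, ⟨by linarith [hs.1], by linarith [hs.2]⟩, rfl⟩
  -- the test map
  set f : ℂ → ℂ := fun z => (z - p) / (z - q) with hf
  -- logarithm on `ℂ \ A₁`: slide `p` to `q` along `A₁`
  have h1 : HasLogOn f A₁ᶜ := by
    refine (hasLogOn_iff_of_homotopy (f := f) (g := fun _ => (1 : ℂ)) (s := A₁ᶜ)
      (fun s z => (z - param e (s / 2)) / (z - q)) ?_ ?_ ?_ ?_).2 (hasLogOn_const one_ne_zero _)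
    · refine ContinuousOn.div ?_ (by fun_prop) ?_
      · have : Continuous fun x : ℝ × ℂ => x.2 - param e (x.1 / 2) := by
          have := continuous_param e
          fun_prop
        exact this.continuousOn
      · rintro ⟨s, z⟩ ⟨-, hz⟩
        exact sub_ne_zero.2 fun h => hz (h ▸ hq₁)
    · intro z _
      show (z - param e (0 / 2)) / (z - q) = (z - p) / (z - q)
      rw [zero_div, ← hp]
    · intro z hz
      have : z - q ≠ 0 := sub_ne_zero.2 fun h => hz (h ▸ hq₁)
      show (z - param e (1 / 2)) / (z - q) = 1
      rw [← hq]
      exact div_self this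
    · intro s hs z hz
      exact div_ne_zero (sub_ne_zero.2 fun h => hz (h ▸ hmem₁ s hs))
        (sub_ne_zero.2 fun h => hz (h ▸ hq₁))
  -- logarithm on `ℂ \ A₂`: slide `q` to `p = γ 1` along `A₂`
  have h2 : HasLogOn f A₂ᶜ := by
    refine (hasLogOn_iff_of_homotopy (f := f) (g := fun _ => (1 : ℂ)) (s := A₂ᶜ)
      (fun s z => (z - p) / (z - param e (1 / 2 + s / 2))) ?_ ?_ ?_ ?_).2
      (hasLogOn_const one_ne_zero _)
    · refine ContinuousOn.div (by fun_prop) ?_ ?_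
      · have : Continuous fun x : ℝ × ℂ => x.2 - param e (1 / 2 + x.1 / 2) := by
          have := continuous_param e
          fun_prop
        exact this.continuousOn
      · rintro ⟨s, z⟩ ⟨hs, hz⟩
        exact sub_ne_zero.2 fun h => hz (h ▸ hmem₂ s hs)
    · intro z _
      show (z - p) / (z - param e (1 / 2 + 0 / 2)) = (z - p) / (z - q)
      rw [zero_div, add_zero, ← hq]
    · intro z hz
      have e1 : param e (1 / 2 + 1 / 2) = p := by rw [hp, ← param_one e]; norm_num
      have : z - p ≠ 0 := sub_ne_zero.2 fun h => hz (h ▸ hp₂)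
      show (z - p) / (z - param e (1 / 2 + 1 / 2)) = 1
      rw [e1]
      exact div_self this
    · intro s hs z hz
      exact div_ne_zero (sub_ne_zero.2 fun h => hz (h ▸ hp₂))
        (sub_ne_zero.2 fun h => hz (h ▸ hmem₂ s hs))
  -- if `ℂ \ C` were connected the logarithms would glue
  have hpre : IsPreconnected (A₁ᶜ ∩ A₂ᶜ) := by
    rw [← compl_union, hunion]
    rcases (Cᶜ : Set ℂ).eq_empty_or_nonempty with h0 | ⟨w, hw⟩
    · rw [h0]
      exact isPreconnected_empty
    · have : Cᶜ = connectedComponentIn Cᶜ w := by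
        refine Subset.antisymm (fun z hz => ?_) (connectedComponentIn_subset _ _)
        rw [hall w z hw hz]
        exact mem_connectedComponentIn hz
      rw [this]
      exact isPreconnected_connectedComponentIn
  have h12 : HasLogOn f (A₁ᶜ ∪ A₂ᶜ) :=
    h1.union_of_isOpen hA₁c.isOpen_compl hA₂c.isOpen_compl hpre h2
  -- a small circle about `p` lies in `ℂ \ (A₁ ∩ A₂)`
  set r : ℝ := ‖q - p‖ / 2 with hr
  have hr0 : 0 < r := by
    have : 0 < ‖q - p‖ := norm_pos_iff.2 (sub_ne_zero.2 hpq.symm)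
    positivity
  have hcirc : ∀ t, circleLoop p r t ∈ A₁ᶜ ∪ A₂ᶜ := by
    intro t
    rw [← compl_inter, mem_compl_iff]
    intro hmem
    have hn := norm_circleLoop_sub_center p r t
    rw [abs_of_pos hr0] at hn
    rcases image_inter_image_subset e hmem with h | h
    · rw [← hp] at h
      rw [h, sub_self, norm_zero] at hn
      exact hr0.ne hn
    · rw [← hq] at h
      rw [h] at hn
      rw [hr] at hn hr0
      linarith
  have hw0 : wind (f ∘ circleLoop p r) = 0 :=
    wind_comp_eq_zero_of_hasLogOn h12 (continuous_circleLoop p r).continuousOn (fun t _ => hcirc t)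
      (circleLoop_zero_eq p r)
  have hw1 : wind (f ∘ circleLoop p r) = 1 := by
    have hl1 : IsNonvanishingLoop fun t => circleLoop p r t - p := by
      have e1 : (fun t => circleLoop p r t - p) = circleLoop 0 r :=
        funext fun t => by rw [circleLoop_sub, sub_self]
      rw [e1]
      exact isNonvanishingLoop_circleLoop (by simp [abs_of_pos hr0, hr0.ne])
    have hl2 : IsNonvanishingLoop fun t => circleLoop p r t - q := by
      have e1 : (fun t => circleLoop p r t - q) = circleLoop (p - q) r :=
        funext fun t => by rw [circleLoop_sub]
      rw [e1]
      refine isNonvanishingLoop_circleLoop ?_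
      rw [abs_of_pos hr0, norm_sub_rev, hr]
      linarith
    change wind (fun t => (circleLoop p r t - p) / (circleLoop p r t - q)) = 1
    rw [wind_div hl1 hl2, wind_circleLoop_sub_of_norm_lt (by simpa using hr0),
      wind_circleLoop_sub_of_lt_norm hr0.le (by rw [hr]; linarith)]
    norm_num
  omega

/-! ### Step 4: the common boundary -/

/-- A proper subarc `γ [a, b]` (`a < b < a + 1`) of `C` is a Jordan arc. [folklore] -/
theorem nonempty_unitInterval_homeomorph_image {a b : ℝ} (hab : a < b) (hba : b < a + 1) :
    Nonempty (unitInterval ≃ₜ param e '' Icc a b) := by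
  have hinj : InjOn (param e) (Icc a b) :=
    (injOn_param_Ico e a).mono (Icc_subset_Ico_right hba)
  let φ : Icc a b → ℂ := fun t => param e t
  have hφc : Continuous φ := (continuous_param e).comp continuous_subtype_val
  have hφinj : Function.Injective φ := fun s t h => Subtype.ext (hinj s.2 t.2 h)
  have hemb : IsClosedEmbedding φ := hφc.isClosedEmbedding hφinj
  have hrange : range φ = param e '' Icc a b := by
    ext z
    simp only [φ, mem_range, Subtype.exists, mem_image, mem_Icc, exists_prop]
  exact ⟨(iccHomeoI a b hab).symm.trans
    (hemb.isEmbedding.toHomeomorph.trans (Homeomorph.setCongr hrange))⟩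

/-- **Common boundary**: if `ℂ \ C` has a component other than that of `a ∉ C`, then the
frontier of the component of `a` is all of `C`. [folklore] -/
theorem frontier_connectedComponentIn_eq {a : ℂ} (ha : a ∉ C)
    (hother : ∃ b, b ∉ C ∧ connectedComponentIn Cᶜ b ≠ connectedComponentIn Cᶜ a) :
    frontier (connectedComponentIn Cᶜ a) = C := by
  have hCcl : IsClosed C := (isCompact_curve e).isClosed
  set U := connectedComponentIn Cᶜ a with hU
  refine Subset.antisymm (Janiszewski.frontier_connectedComponentIn_subset hCcl a) fun z₀ hz₀ => ?_
  by_contra hzfr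
  obtain ⟨b, hb, hbU⟩ := hother
  obtain ⟨t₀, rfl⟩ : z₀ ∈ range (param e) := by rwa [range_param]
  -- a parameter window around `t₀` avoiding the closed set `frontier U`
  obtain ⟨δ, hδ, hδ1, hball⟩ : ∃ δ > 0, δ < 1 / 2 ∧
      ∀ t, |t - t₀| < δ → param e t ∉ frontier U := by
    have hmem : (frontier U)ᶜ ∈ 𝓝 (param e t₀) :=
      isClosed_frontier.isOpen_compl.mem_nhds hzfr
    obtain ⟨ε, hε, hεball⟩ := Metric.mem_nhds_iff.1 ((continuous_param e).continuousAt hmem)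
    refine ⟨min ε (1 / 4), lt_min hε (by norm_num), (min_le_right _ _).trans_lt (by norm_num),
      fun t ht => hεball ?_⟩
    rw [mem_ball, Real.dist_eq]
    exact ht.trans_le (min_le_left _ _)
  -- the arc `Λ = γ [t₀ + δ, t₀ + 1 - δ]` contains `frontier U`
  set Λ := param e '' Icc (t₀ + δ) (t₀ + 1 - δ) with hΛ
  have hΛC : Λ ⊆ C := image_subset_iff.2 fun t _ => param_mem e t
  have hfrΛ : frontier U ⊆ Λ := by
    intro z hz
    have hzC : z ∈ C := Janiszewski.frontier_connectedComponentIn_subset hCcl a hz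
    obtain ⟨t, ht, rfl⟩ := surjOn_param_Ico e (t₀ - δ) hzC
    rcases eq_or_lt_of_le ht.1 with h | h
    · -- `t = t₀ - δ`: use periodicity
      refine ⟨t₀ + 1 - δ, ⟨by linarith, le_rfl⟩, ?_⟩
      rw [← h, show t₀ + 1 - δ = (t₀ - δ) + 1 by ring, param_add_one]
    · by_cases hlt : t < t₀ + δ
      · exact absurd hz (hball t (abs_sub_lt_iff.2 ⟨by linarith, by linarith⟩))
      · exact ⟨t, ⟨not_lt.1 hlt, by linarith [ht.2]⟩, rfl⟩
  -- `ℂ \ Λ` is connected, contains `a`, misses `frontier U`, hence lies in `U`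
  have hΛconn : IsConnected Λᶜ :=
    JordanArcSeparation_holds Λ (nonempty_unitInterval_homeomorph_image e (by linarith) (by linarith))
  have haΛ : a ∈ Λᶜ := fun h => ha (hΛC h)
  have hsub : Λᶜ ⊆ U :=
    hΛconn.isPreconnected.subset_of_closure_inter_subset (isOpen_connectedComponentIn_compl hCcl a)
      ⟨a, haΛ, mem_connectedComponentIn ha⟩ (by
        rw [closure_eq_self_union_frontier]
        rintro z ⟨hz | hz, hzΛ⟩
        · exact hz
        · exact absurd (hfrΛ hz) hzΛ)
  have hbΛ : b ∈ Λᶜ := fun h => hb (hΛC h)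
  exact hbU (connectedComponentIn_eq (hsub hbΛ)).symm

end JordanCurveProof

/-- **The Jordan curve theorem** (McCleary, *A First Course in Topology* (2006), Ch. 9, p. 129):
the complement of a subset of the plane homeomorphic to the circle has exactly two components,
each with the curve as its frontier. Proved here by Eilenberg's continuous-logarithm method
(`WindingNumber.lean`, `EilenbergCriterion.lean`, and the four steps of this file); this
discharges the named fact `Literature.Topology.PlaneTopology.JordanCurveTheorem`. [cite: Mccleary2006, Ch. 9, p. 129 (The Jordan Curve Theorem)] -/
theorem JordanCurveTheorem_holds : JordanCurveTheorem := by
  rintro C ⟨e⟩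
  obtain ⟨x, y, hx, hy, hne⟩ := JordanCurveProof.exists_ne_connectedComponentIn e
  exact ⟨x, y, hx, hy, hne, fun z hz => JordanCurveProof.mem_or_mem_of_ne e hx hy hne hz,
    JordanCurveProof.frontier_connectedComponentIn_eq e hx ⟨y, hy, hne.symm⟩,
    JordanCurveProof.frontier_connectedComponentIn_eq e hy ⟨x, hx, hne⟩⟩

end Literature.Topology.PlaneTopology
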